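import Summits.CriticalPhenomena.PercolationContinuityZ3.Theorems.Transplant.SqShadowFact1Crossing
import Summits.CriticalPhenomena.PercolationContinuityZ3.Theorems.Transplant.SqShadowSideSqrt
import Literature.Probability.Percolation.SlabGluingFact1
import HarnessLib

/-!
# SQUARE SHADOWS XIV — Fact 1 of DST §2.3 in square geometry, II: the uniform column bound and Lemma 7 — **`SqShadow.sqFact1_holds : Ψ.SqFact1`**

builds on p205010 (kernel theorem, internal audit signed; external expert review pending) — NOT used in this file.
Lane `prim-bschramm`, seat `prim-bschramm-p2` (gen 42; class C1b; memo `HOME/bschramm/P2-LATTICES.md` §148); helper file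
(`--supports stmt-CriticalPhenomena-4575 --as helper`).  Hexagonal twin «HexShadowFact1»; slab original `Literature/…/SlabGluingFact1` §"ColumnEdges"/"Fact1Proof" (`lemma7_bond` — generic, reused).
* §1 the UNIFORM column bound of a square shadow: every unit-square lift `\overline{sqBall q 1}` has at most `liftBound = |\overline{sqBall c (2·period)}|` vertices (reduce `q` modulo the
  period and translate by a lifted symmetry), hence at most `liftBound²` lattice edges have an endpoint on a given column, and at most `liftBound² · |U|` on the columns of a finite `U`;
* §2 **`sqFact1_holds`**: `P[𝒳 ∩ {|U| < t}] ≤ (2/min{p,1−p})^{liftBound²·t} · P[(B⁻ ∩ B⁺)ᶜ]` — Lemma 7 applied to the closing map `phi1` of «SqShadowFact1Crossing».  With «SqShadowGlueEvents»: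
  `SqGluing ⇐ SqFact2` alone (`sqGluing_of_fact2`).
[cite: DuminilCopinSidoraviciusTassion2016, §2.3 (Fact 1 and its proof, p. 6; Lemma 7)]
-/

noncomputable section

namespace Summit.CriticalPhenomena.PercolationContinuityZ3.Theorems.Transplant

open MeasureTheory Literature.Probability.Percolation Literature.Probability.LatticeModels SimpleGraph Filter
open scoped Classical Topology

namespace SqShadow

variable {V : Type} {G : SimpleGraph V} (Ψ : SqShadow G)

/-! ## §1 The uniform column bound -/

/-- The uniform bound on the size of unit-square lifts: the number of vertices over `sqBall c (2·period)`. [folklore] -/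
def liftBound : ℕ := (Ψ.lift (sqBall Ψ.centre (2 * Ψ.period))).ncard

/-- **Every unit-square lift has at most `liftBound` vertices** (it lies in a symmetry translate of `\overline{sqBall c (2·period)}`). [folklore] -/
theorem ncard_lift_sqBall_one_le (q : Site 2) : (Ψ.lift (sqBall q 1)).ncard ≤ Ψ.liftBound := by
  obtain ⟨t, ht⟩ := Ψ.exists_sqBall_one_subset q
  obtain ⟨γ, hγ⟩ := Ψ.shift t
  set d : Site 2 := (Ψ.period : ℤ) • t with hd
  have hγg : ∀ w, Ψ.sh (γ w) = Equiv.addRight d (Ψ.sh w) := fun w => by rw [Equiv.coe_addRight, hγ]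
  have e1 : Ψ.lift (sqBall (Ψ.centre + d) (2 * Ψ.period)) = γ '' Ψ.lift (sqBall Ψ.centre (2 * Ψ.period)) := by
    rw [← image_addRight_sqBall d Ψ.centre, Ψ.image_lift γ (Equiv.addRight d) hγg]
  calc (Ψ.lift (sqBall q 1)).ncard ≤ (Ψ.lift (sqBall (Ψ.centre + d) (2 * Ψ.period))).ncard :=
        Set.ncard_le_ncard (Ψ.lift_mono ht) (Ψ.lift_finite (sqBall_finite _ _))
    _ = (γ '' Ψ.lift (sqBall Ψ.centre (2 * Ψ.period))).ncard := by rw [e1]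
    _ = Ψ.liftBound := Set.ncard_image_of_injective _ γ.injective

/-- A lattice edge with an endpoint on the column over `z` has both endpoints over `sqBall z 1`. [folklore] -/
theorem mem_image_of_edge {z : Site 2} {e : Sym2 V} (he : e ∈ G.edgeSet) (hu : ∃ u ∈ e, Ψ.sh u = z) :
    e ∈ (fun p : V × V => s(p.1, p.2)) '' (Ψ.lift (sqBall z 1) ×ˢ Ψ.lift (sqBall z 1)) := by
  obtain ⟨u, hue, huz⟩ := hu
  induction e using Sym2.ind with
  | h a b =>
    have hadj : G.Adj a b := (SimpleGraph.mem_edgeSet _).1 he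
    have key : ∀ {a b : V}, G.Adj a b → Ψ.sh a = z → a ∈ Ψ.lift (sqBall z 1) ∧ b ∈ Ψ.lift (sqBall z 1) := by
      intro a b hab haz
      constructor
      · rw [mem_lift, haz]; exact centre_mem_sqBall z 1
      · rw [mem_lift, mem_sqBall, Nat.cast_one, ← haz, abs_sub_comm (Ψ.sh b 0), abs_sub_comm (Ψ.sh b 1)]
        exact ⟨Ψ.abs_sh_sub_sh_le_one hab 0, Ψ.abs_sh_sub_sh_le_one hab 1⟩
    rcases Sym2.mem_iff.1 hue with rfl | rfl
    · obtain ⟨h1, h2⟩ := key hadj huz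
      exact ⟨(u, b), ⟨h1, h2⟩, rfl⟩
    · obtain ⟨h1, h2⟩ := key hadj.symm huz
      exact ⟨(a, u), ⟨h2, h1⟩, rfl⟩

/-- **At most `liftBound²` lattice edges have an endpoint on a given column.** [folklore] -/
theorem card_filter_col_le (K : Finset (Sym2 V)) (hK : ∀ e ∈ K, e ∈ G.edgeSet) (z : Site 2) :
    (K.filter fun e => ∃ u ∈ e, Ψ.sh u = z).card ≤ Ψ.liftBound ^ 2 := by
  set F := Ψ.lift (sqBall z 1) with hF
  have hFfin : F.Finite := Ψ.lift_finite (sqBall_finite z 1)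
  have hsub : (↑(K.filter fun e => ∃ u ∈ e, Ψ.sh u = z) : Set (Sym2 V)) ⊆ (fun p : V × V => s(p.1, p.2)) '' (F ×ˢ F) := by
    intro e he
    rw [Finset.coe_filter] at he
    exact Ψ.mem_image_of_edge (hK e he.1) he.2
  have hprodfin : (F ×ˢ F).Finite := hFfin.prod hFfin
  calc (K.filter fun e => ∃ u ∈ e, Ψ.sh u = z).card = (↑(K.filter fun e => ∃ u ∈ e, Ψ.sh u = z) : Set (Sym2 V)).ncard := (Set.ncard_coe_finset _).symm
    _ ≤ ((fun p : V × V => s(p.1, p.2)) '' (F ×ˢ F)).ncard := Set.ncard_le_ncard hsub (hprodfin.image _)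
    _ ≤ (F ×ˢ F).ncard := Set.ncard_image_le hprodfin
    _ = F.ncard * F.ncard := Set.ncard_prod
    _ ≤ Ψ.liftBound * Ψ.liftBound := Nat.mul_le_mul (Ψ.ncard_lift_sqBall_one_le z) (Ψ.ncard_lift_sqBall_one_le z)
    _ = Ψ.liftBound ^ 2 := (sq _).symm

/-- **At most `liftBound² · |U|` lattice edges have an endpoint on the columns of a finite set `U`.** [folklore] -/
theorem card_filter_cols_le (K : Finset (Sym2 V)) (hK : ∀ e ∈ K, e ∈ G.edgeSet) (Uz : Finset (Site 2)) :
    (K.filter fun e => ∃ u ∈ e, Ψ.sh u ∈ Uz).card ≤ Ψ.liftBound ^ 2 * Uz.card := by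
  have hsub : (K.filter fun e => ∃ u ∈ e, Ψ.sh u ∈ Uz) ⊆ Uz.biUnion fun z => K.filter fun e => ∃ u ∈ e, Ψ.sh u = z := by
    intro e he
    obtain ⟨heK, u, hue, huz⟩ := Finset.mem_filter.1 he
    rw [Finset.mem_biUnion]
    exact ⟨Ψ.sh u, huz, Finset.mem_filter.2 ⟨heK, u, hue, rfl⟩⟩
  calc (K.filter fun e => ∃ u ∈ e, Ψ.sh u ∈ Uz).card ≤ (Uz.biUnion fun z => K.filter fun e => ∃ u ∈ e, Ψ.sh u = z).card := Finset.card_le_card hsub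
    _ ≤ ∑ z ∈ Uz, (K.filter fun e => ∃ u ∈ e, Ψ.sh u = z).card := Finset.card_biUnion_le
    _ ≤ ∑ _z ∈ Uz, Ψ.liftBound ^ 2 := Finset.sum_le_sum fun z _ => Ψ.card_filter_col_le K hK z
    _ = Ψ.liftBound ^ 2 * Uz.card := by rw [Finset.sum_const, smul_eq_mul, mul_comm]

/-! ## §2 Fact 1 by Lemma 7 -/

variable [Countable V]

/-- **FACT 1, quantitative form**: `P[𝒳 ∩ {|U| < t}] ≤ (2/min{p,1−p})^{liftBound²·t} · P[(B⁻ ∩ B⁺)ᶜ]` for `0 < p < 1` and data in range.  The proof of DST §2.3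
verbatim: the closing map `Ψ : ω ↦ ω'` sends `𝒳 ∩ {|U| < t}` into `(B⁻ ∩ B⁺)ᶜ` (`phi1_not_mem`), `γ_min(Ψω) = γ_min(ω)` and `U(Ψω) = U(ω)`, so the preimages of `ω'`
agree with `ω'` off the `≤ liftBound²·t` lattice edges at the columns of `U(ω')`; Lemma 7 (`lemma7_bond`, single-valued) concludes.
[cite: DuminilCopinSidoraviciusTassion2016, §2.3 (Fact 1 and its proof)] -/
theorem fact1_bound (p : unitInterval) (hp0 : 0 < (p : ℝ)) (hp1 : (p : ℝ) < 1) (D : GlueData) (hD : Ψ.InRange D) (t : ℕ) :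
    (bondPercolation G p).real (Ψ.evX D ∩ {ω | (Ψ.U D ω).ncard < t}) ≤
      (2 / min (p : ℝ) (1 - p)) ^ (Ψ.liftBound ^ 2 * t) * (bondPercolation G p).real (Ψ.glueBm D.m D.u₁ D.a D.s ∩ Ψ.glueBp D.m D.u₁ D.a D.s)ᶜ := by
  classical
  set P := bondPercolation G p with hP
  -- the window
  have hRfin := Ψ.lift_window_finite D
  set K' : Finset (Sym2 V) := (finite_sym2 hRfin).toFinset with hK'def
  have hK'coe : (↑K' : Set (Sym2 V)) = (Ψ.lift (Ψ.big D ∪ Ψ.small D)).sym2 := Set.Finite.coe_toFinset _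
  set Kfin : Finset (Sym2 V) := K'.filter (· ∈ G.edgeSet) with hKfin
  have hK : ∀ e, e ∈ Kfin ↔ e ∈ K' ∧ e ∈ G.edgeSet := fun e => Finset.mem_filter
  have hKE : ∀ e ∈ Kfin, e ∈ G.edgeSet := fun e he => ((hK e).1 he).2
  -- agreement on the window
  have hagree : ∀ ω ω' : BondConfig V, ω ∩ ↑K' = ω' ∩ ↑K' → ∀ e ∈ (Ψ.lift (Ψ.big D ∪ Ψ.small D)).sym2, e ∈ ω ↔ e ∈ ω' := by
    intro ω ω' heq e he
    rw [← hK'coe] at he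
    have := Set.ext_iff.1 heq e
    simp only [Set.mem_inter_iff, he, and_true] at this
    exact this
  have hA : DeterminedBy (Ψ.evX D ∩ {ω | (Ψ.U D ω).ncard < t}) ↑K' := by
    rw [determinedBy_iff]
    intro ω ω' heq
    simp only [Set.mem_inter_iff, Set.mem_setOf_eq]
    rw [Ψ.mem_evX_congr D (hagree ω ω' heq), Ψ.U_congr D (hagree ω ω' heq)]
  have hB : DeterminedBy (Ψ.glueBm D.m D.u₁ D.a D.s ∩ Ψ.glueBp D.m D.u₁ D.a D.s)ᶜ ↑K' := by
    rw [determinedBy_iff]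
    intro ω ω' heq
    have h := hagree ω ω' heq
    simp only [Set.mem_compl_iff, Set.mem_inter_iff, glueBm_eq, glueBp_eq]
    rw [Ψ.mem_conn_congr D h (B := Ψ.small D) Set.subset_union_right, Ψ.mem_conn_congr D h (B := Ψ.small D) Set.subset_union_right]
  -- the map, on lattice configurations inside the window
  let Θ : Finset (Sym2 V) → Finset (Finset (Sym2 V)) := fun S => {S.filter (· ∉ Ψ.closeSet D ↑S)}
  have hΘcoe : ∀ S : Finset (Sym2 V), (↑(S.filter (· ∉ Ψ.closeSet D ↑S)) : Set (Sym2 V)) = Ψ.phi1 D ↑S := by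
    intro S; ext e; simp [phi1]
  have hmain := lemma7_bond G p hp0 hp1 K' Kfin hK hA hB (Ψ.liftBound ^ 2 * t) one_pos Θ ?_ ?_ ?_
  · simpa using hmain
  · -- images lie in `B`
    intro S hS hSA S' hS'
    have hS'eq : S' = S.filter (· ∉ Ψ.closeSet D ↑S) := Finset.mem_singleton.1 hS'
    subst hS'eq
    refine ⟨(Finset.filter_subset _ S).trans hS, ?_⟩
    rw [hΘcoe]
    exact Ψ.phi1_not_mem D hD (fun e he => hKE e (hS he)) hSA.1
  · -- one image
    intro S _ _
    simp [Θ]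
  · -- preimages agree off the edges at the columns of `U(ω')`
    intro S' hS' _
    by_cases hsmall : (Ψ.U D ↑S').ncard < t
    · refine ⟨Kfin.filter fun e => ∃ u ∈ e, Ψ.sh u ∈ (Ψ.U_finite D (↑S' : BondConfig V)).toFinset, ?_, ?_⟩
      · refine (Ψ.card_filter_cols_le Kfin hKE _).trans ?_
        rw [← Set.ncard_eq_toFinset_card _ (Ψ.U_finite D (↑S' : BondConfig V))]
        exact Nat.mul_le_mul_left _ hsmall.le
      · intro S hS hSA hmem e heT
        have hS'eq : S' = S.filter (· ∉ Ψ.closeSet D ↑S) := Finset.mem_singleton.1 hmem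
        constructor
        · intro heS
          by_contra heS'
          apply heT
          have hdiff : e ∈ (↑S : Set (Sym2 V)) \ Ψ.phi1 D ↑S := by
            refine ⟨heS, ?_⟩
            rw [← hΘcoe, ← hS'eq]
            exact heS'
          obtain ⟨u, hue, hu⟩ := Ψ.diff_phi1_subset D hSA.1 hdiff
          rw [← hΘcoe, ← hS'eq] at hu
          exact Finset.mem_filter.2 ⟨hS heS, u, hue, (Set.Finite.mem_toFinset _).2 hu⟩
        · intro heS'
          rw [hS'eq] at heS'
          exact (Finset.mem_filter.1 heS').1
    · refine ⟨∅, by simp, ?_⟩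
      intro S hS hSA hmem
      exfalso
      apply hsmall
      have hS'eq : S' = S.filter (· ∉ Ψ.closeSet D ↑S) := Finset.mem_singleton.1 hmem
      rw [hS'eq, hΘcoe, Ψ.U_phi1 D hSA.1]
      exact hSA.2

/-- **FACT 1 OF DST §2.3 HOLDS IN SQUARE GEOMETRY** (node `SqFact1` of «SqShadowGlueEvents» discharged, for every graph with a square shadow).
[cite: DuminilCopinSidoraviciusTassion2016, §2.3 (Fact 1)] -/
theorem sqFact1_holds : Ψ.SqFact1 := by
  intro p hp0 hp1 t
  exact ⟨(2 / min (p : ℝ) (1 - p)) ^ (Ψ.liftBound ^ 2 * t), fun D hD => Ψ.fact1_bound p hp0 hp1 D hD t⟩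

/-- **THE GLUING LEMMA FROM FACT 2 ALONE**: `SqFact2 → SqGluing`. [cite: DuminilCopinSidoraviciusTassion2016, Lemma 6 and §2.3] -/
theorem sqGluing_of_fact2 (h2 : Ψ.SqFact2) : Ψ.SqGluing := Ψ.sqGluing_of_facts Ψ.sqFact1_holds h2

end SqShadow

end Summit.CriticalPhenomena.PercolationContinuityZ3.Theorems.Transplant

end
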